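import Summits.QuantumFields.YangMills.Theorems.ColdStartUniversalityLatticeLangevinLezaudBernstein
import HarnessLib

/-!
# Route `ColdStartUniversality` (fixed-cut-off SZZ dynamics, sampler statistics): tools for LEZAUD'S BOUND ON ALL BOUNDED MEASURABLE
# OBSERVABLES — `L¹(μ)`-approximation by continuous observables, and FUBINI + WARM START for time integrals along the dynamics

Helper file (seat `ym-line-csu-p1`, g37; `--supports stmt-QuantumFields-24809`).  SU(2) lattice Langevin dynamics of Shen–Zhu–Zhu at `(L, β')`,
Wilson measure `μ = μ_{β'}`.  `…LezaudBernstein` proves the volume-free exponential-moment / Bernstein bounds for time averages of bounded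
CONTINUOUS observables; to pass to bounded MEASURABLE ones (occupation times) the sequel approximates in `L¹(μ)` and controls the error
along the dynamics.  This file supplies the tools:
* `abs_sub_clamp_le`, ★ `exists_continuous_abs_le_one_integral_abs_sub_le` — a measurable `G` with `|G| ≤ 1` is `L¹(μ_{β'})`-approximated
  by continuous `g` with `|g| ≤ 1` (Mathlib's `Integrable.exists_boundedContinuous_integral_sub_le` on the compact metrisable configuration
  space, clamped to `[-1, 1]`); (the Lipschitz bound `|eˣ − eʸ| ≤ e^B|x − y|` is the tree's `TangentSteinFiniteBeta.abs_exp_sub_exp_le`);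
* ★★ `coldStart_integral_abs_timeIntegral_le_uniform` — for `|β'| < 1/12`, a JOINTLY MEASURABLE strong solution from a deterministic start,
  every bounded measurable `φ`, burn-in `log B ≤ 2(1 − 12|β'|)t₀` and `T > 0`:
  `E|∫_{(0,T]} φ(U_{2+t₀+u+r}) dr| ≤ T · e · (∫ φ² dμ_{β'})^{1/2}` (Fubini and the `L²`-warm start `coldStart_warmStart_uniform` at each time)
  — uniformly in `L`.
[cite: DiaconisSaloffcoste1996, Theorem 3.7] [cite: Lezaud2001, Theorem 1.1].  THEOREMS ONLY, no definition, no sorry.  HONEST FRAMING: RECORD-rung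
R3 plumbing at FIXED cut-off; nothing K-uniform; no crux, rung or summit statement is proved; the Yang–Mills mass gap is NOT proved.
-/

set_option autoImplicit false

noncomputable section

namespace Summit.QuantumFields.YangMills.Theorems.ColdStartUniversality

open MeasureTheory ProbabilityTheory Filter Set Topology
open scoped BigOperators NNReal ENNReal
open Literature.Probability.Process Literature.MathematicalPhysics.QuantumFieldTheory
open Literature.MathematicalPhysics.QuantumLattice (fundamentalRep fundamentalLatticeRep continuous_fundamentalRep)

variable {L : ℕ} [NeZero L]

/-! ## §1. Clamping -/

/-- Clamping to `[-1, 1]` does not increase the distance to a point of `[-1, 1]`. [folklore] -/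
theorem abs_sub_clamp_le {a y : ℝ} (ha : |a| ≤ 1) : |a - max (-1) (min 1 y)| ≤ |a - y| := by
  obtain ⟨ha1, ha2⟩ := abs_le.1 ha
  rcases le_total 1 y with hy | hy
  · rw [min_eq_left hy, max_eq_right (by norm_num : (-1 : ℝ) ≤ 1), abs_of_nonpos (by linarith : a - 1 ≤ 0),
      abs_of_nonpos (by linarith : a - y ≤ 0)]
    linarith
  · rw [min_eq_right hy]
    rcases le_total y (-1) with hy' | hy'
    · rw [max_eq_left hy', abs_of_nonneg (by linarith : 0 ≤ a - -1), abs_of_nonneg (by linarith : 0 ≤ a - y)]; linarith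
    · rw [max_eq_right hy']

/-! ## §2. `L¹(μ_{β'})`-approximation of bounded measurable observables by continuous ones -/

/-- ★ A measurable observable `G` with `|G| ≤ 1` is approximated in `L¹(μ_{β'})` by continuous `g` with `|g| ≤ 1` (bounded continuous
functions are dense in `L¹` of the compact metrisable configuration space; clamp to `[-1, 1]`). [folklore] -/
theorem exists_continuous_abs_le_one_integral_abs_sub_le (L : ℕ) [NeZero L] (β' : ℝ)
    {G : GaugeConfig 3 L (Matrix.specialUnitaryGroup (Fin 2) ℂ) → ℝ} (hG : Measurable G) (hG1 : ∀ x, |G x| ≤ 1) {δ : ℝ} (hδ : 0 < δ) :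
    ∃ g : GaugeConfig 3 L (Matrix.specialUnitaryGroup (Fin 2) ℂ) → ℝ, Continuous g ∧ (∀ x, |g x| ≤ 1) ∧
      ∫ x, |G x - g x| ∂(wilsonMeasure (d := 3) (L := L) (fundamentalRep (Fin 2)) β') ≤ δ := by
  classical
  haveI := secondCountableTopology_su2
  haveI := borelSpace_config L
  haveI := polishSpace_config L
  haveI : IsProbabilityMeasure (wilsonMeasure (d := 3) (L := L) (fundamentalRep (Fin 2)) β') :=
    isProbabilityMeasure_wilsonMeasure (d := 3) (L := L) (fundamentalRep (Fin 2)) (continuous_fundamentalRep (Fin 2)) β'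
  have hint : Integrable G (wilsonMeasure (d := 3) (L := L) (fundamentalRep (Fin 2)) β') := FeynmanKac.integrable_of_measurable_of_abs_le _ hG hG1
  obtain ⟨g, hg, hgi⟩ := hint.exists_boundedContinuous_integral_sub_le (μ := (wilsonMeasure (d := 3) (L := L) (fundamentalRep (Fin 2)) β')) hδ
  have hclamp1 : ∀ x, |max (-1 : ℝ) (min 1 (g x))| ≤ 1 := fun x => abs_le.2 ⟨le_max_left _ _, max_le (by norm_num) (min_le_left _ _)⟩
  refine ⟨fun x => max (-1) (min 1 (g x)), continuous_const.max (continuous_const.min g.continuous), hclamp1, ?_⟩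
  have hcm : Measurable fun x => max (-1 : ℝ) (min 1 (g x)) := measurable_const.max (measurable_const.min g.continuous.measurable)
  have i1 : Integrable (fun x => |G x - max (-1) (min 1 (g x))|) (wilsonMeasure (d := 3) (L := L) (fundamentalRep (Fin 2)) β') :=
    FeynmanKac.integrable_of_measurable_of_abs_le _ ((hG.sub hcm).abs) (B := 2) fun x => by
      rw [abs_abs]; exact (abs_sub _ _).trans (by linarith [hG1 x, hclamp1 x])
  have i2 : Integrable (fun x => ‖G x - g x‖) (wilsonMeasure (d := 3) (L := L) (fundamentalRep (Fin 2)) β') := (hint.sub hgi).norm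
  calc ∫ x, |G x - max (-1) (min 1 (g x))| ∂(wilsonMeasure (d := 3) (L := L) (fundamentalRep (Fin 2)) β') ≤ ∫ x, ‖G x - g x‖ ∂(wilsonMeasure (d := 3) (L := L) (fundamentalRep (Fin 2)) β') :=
        integral_mono i1 i2 fun x => by rw [Real.norm_eq_abs]; exact abs_sub_clamp_le (hG1 x)
    _ ≤ δ := hg

/-! ## §3. Fubini + warm start: `E|∫ φ(U_{a+r}) dr| ≤ T·e·‖φ‖₂` -/

/-- ★★ **Time integrals of bounded observables after the burn-in are `L¹(P)`-controlled by the `L²(μ)`-norm, uniformly in `L`.**  For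
`|β'| < 1/12`, a JOINTLY MEASURABLE strong solution `U` from a deterministic start, every bounded measurable `φ`, burn-in
`log B ≤ 2(1 − 12|β'|)t₀` and `T > 0`:  `E|∫_{(0,T]} φ(U_{2+t₀+u+r}) dr| ≤ T · e · (∫ φ² dμ_{β'})^{1/2}`
(Fubini and the warm start `coldStart_warmStart_uniform` at each time `2 + t₀ + (u + r)`). [cite: DiaconisSaloffcoste1996, Theorem 3.7] -/
theorem coldStart_integral_abs_timeIntegral_le_uniform (L : ℕ) [NeZero L] (β' : ℝ) (hβ : |β'| < 1 / 12)
    (z : GaugeConfig 3 L (Matrix.specialUnitaryGroup (Fin 2) ℂ))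
    {Ω : Type} [MeasurableSpace Ω] {P : Measure Ω} [IsProbabilityMeasure P]
    {W : ℝ≥0 → Ω → (Edge 3 L × NoiseIdx 2 → ℝ)} (hW : IsFlatBrownian W P)
    {U : ℝ≥0 → Ω → GaugeConfig 3 L (Matrix.specialUnitaryGroup (Fin 2) ℂ)} (hU0 : ∀ ω, U 0 ω = z)
    (hU : (latticeLangevinDynamics (fundamentalLatticeRep 2) β').IsSolution (fundamentalRep (Fin 2)) hW.natFiltration P W U)
    (hUj : Measurable (Function.uncurry U))
    {φ : GaugeConfig 3 L (Matrix.specialUnitaryGroup (Fin 2) ℂ) → ℝ} (hφ : Measurable φ) {M : ℝ} (hM : ∀ x, |φ x| ≤ M) (t₀ u : ℝ≥0)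
    (ht₀ : Real.log (96 * |β'| * (Fintype.card (Edge 3 L) : ℝ) + 10 * |β'| * (Fintype.card (Plaquette 3 L) : ℝ) + Real.log 2 +
      (Fintype.card (Edge 3 L) : ℝ) * Real.log (3 / 2)) ≤ 2 * (1 - 12 * |β'|) * t₀)
    {T : ℝ} (hT : 0 < T) :
    ∫ ω, |∫ r in Ioc 0 T, φ (U (2 + t₀ + u + r.toNNReal) ω)| ∂P ≤
      T * (Real.exp 1 * (∫ x, φ x ^ 2 ∂(wilsonMeasure (d := 3) (L := L) (fundamentalRep (Fin 2)) β')) ^ (1 / (2 : ℝ))) := by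
  classical
  haveI : IsFiniteMeasure (volume.restrict (Ioc (0 : ℝ) T)) := isFiniteMeasure_restrict.2 measure_Ioc_lt_top.ne
  -- joint measurability of the integrand `(ω, r) ↦ |φ(U_{a+r} ω)|`
  have hf : Measurable fun p : Ω × ℝ => |φ (U (2 + t₀ + u + p.2.toNNReal) p.1)| :=
    (hφ.comp (hUj.comp (((measurable_real_toNNReal.comp measurable_snd).const_add (2 + t₀ + u)).prodMk measurable_fst))).abs
  have hInt : Integrable (Function.uncurry fun (ω : Ω) (r : ℝ) => |φ (U (2 + t₀ + u + r.toNNReal) ω)|)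
      (P.prod (volume.restrict (Ioc (0 : ℝ) T))) :=
    FeynmanKac.integrable_of_measurable_of_abs_le _ hf (B := M) fun p => by
      show |(|φ (U (2 + t₀ + u + p.2.toNNReal) p.1)|)| ≤ M
      rw [abs_abs]; exact hM _
  -- pointwise: `|∫ φ(U)| ≤ ∫ |φ(U)|`, then Fubini
  have h1 : ∫ ω, |∫ r in Ioc 0 T, φ (U (2 + t₀ + u + r.toNNReal) ω)| ∂P ≤
      ∫ ω, (∫ r in Ioc 0 T, |φ (U (2 + t₀ + u + r.toNNReal) ω)|) ∂P :=
    integral_mono_of_nonneg (ae_of_all _ fun ω => abs_nonneg _) hInt.integral_prod_left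
      (ae_of_all _ fun ω => abs_integral_le_integral_abs)
  have h2 : ∫ ω, (∫ r in Ioc 0 T, |φ (U (2 + t₀ + u + r.toNNReal) ω)|) ∂P =
      ∫ r in Ioc 0 T, (∫ ω, |φ (U (2 + t₀ + u + r.toNNReal) ω)| ∂P) := integral_integral_swap hInt
  -- the warm start at each time `2 + t₀ + (u + r)`
  have h3 : ∀ r : ℝ, ∫ ω, |φ (U (2 + t₀ + u + r.toNNReal) ω)| ∂P ≤ Real.exp 1 * (∫ x, φ x ^ 2 ∂(wilsonMeasure (d := 3) (L := L) (fundamentalRep (Fin 2)) β')) ^ (1 / (2 : ℝ)) := by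
    intro r
    have hw := coldStart_warmStart_uniform L β' hβ z hW hU0 hU hφ.abs (M := M) (fun x => by rw [abs_abs]; exact hM x) t₀
      (u + r.toNNReal) ht₀
    rw [← add_assoc] at hw
    have e : ∫ x, |φ x| ^ 2 ∂(wilsonMeasure (d := 3) (L := L) (fundamentalRep (Fin 2)) β') = ∫ x, φ x ^ 2 ∂(wilsonMeasure (d := 3) (L := L) (fundamentalRep (Fin 2)) β') := integral_congr_ae (ae_of_all _ fun x => sq_abs _)
    rw [e] at hw
    exact (le_abs_self _).trans hw
  have h4 : ∫ r in Ioc 0 T, (∫ ω, |φ (U (2 + t₀ + u + r.toNNReal) ω)| ∂P) ≤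
      ∫ r in Ioc 0 T, Real.exp 1 * (∫ x, φ x ^ 2 ∂(wilsonMeasure (d := 3) (L := L) (fundamentalRep (Fin 2)) β')) ^ (1 / (2 : ℝ)) :=
    have hI2 : IntegrableOn (fun r : ℝ => ∫ ω, |φ (U (2 + t₀ + u + r.toNNReal) ω)| ∂P) (Ioc 0 T) volume := hInt.integral_prod_right
    setIntegral_mono_on hI2 (integrableOn_const measure_Ioc_lt_top.ne) measurableSet_Ioc fun r _ => h3 r
  rw [setIntegral_const, Real.volume_real_Ioc_of_le hT.le, sub_zero, smul_eq_mul] at h4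
  exact h1.trans (h2.le.trans h4)

end Summit.QuantumFields.YangMills.Theorems.ColdStartUniversality

end
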